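import Literature.NumberTheory.Sieve.Maynard2016Lemma7PerTuple
import Literature.NumberTheory.Sieve.Maynard2016Lemma6MainTermProof

/-!
# Maynard (2016), Theorem 1: the kernel frontier is `Lemma7Tuple` alone

Trunk: AntSieve / parity (Maynard 2016 large-gaps ladder).

J. Maynard, *Large gaps between primes*, Ann. of Math. 183 (2016) = arXiv:1408.5110.  With Lemma 6
now a theorem of the tree (`Maynard2016.maynard2016_lemma6_holds`, file
`Maynard2016Lemma6MainTermProof.lean`) and Lemma 8, Lemmas 2–3, Proposition 5′ and the §2 reduction
proved earlier, Theorem 1 (`Maynard2016_theorem1`: `G(X) ≥ c · log X · log₂ X · log₄ X / log₃ X`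
for every `c`) follows from the single named fact `Maynard2016.Lemma7Tuple` (the per-tuple-element
form of Lemma 7, displays (6.23)–(6.31), (6.33)).  This file records the two one-line corollaries.

## References

* J. Maynard, *Large gaps between primes*, Ann. of Math. (2) 183 (2016), 915–933; arXiv:1408.5110,
  Theorem 1, Lemmas 6–7. [Maynard2016LargeGaps]
-/

namespace Literature.NumberTheory.Sieve

namespace Maynard2016

/-- **Theorem 1 of Maynard (2016) from `Lemma7Tuple` alone** (Lemma 6 is proved in the tree).
[cite: Maynard2016LargeGaps, Theorem 1] -/
theorem theorem1_of_lemma7Tuple (h7 : Lemma7Tuple) :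
    Literature.NumberTheory.Sieve.Maynard2016_theorem1 :=
  theorem1_of_lemma6_tuple maynard2016_lemma6_holds h7

/-- **Rankin's bound with an arbitrary constant from `Lemma7Tuple` alone.**
[cite: Maynard2016LargeGaps, Theorem 1] -/
theorem forall_rankinConstant_of_lemma7Tuple (h7 : Lemma7Tuple) (c : ℝ) :
    Literature.NumberTheory.Sieve.RankinConstant c :=
  forall_rankinConstant_of_lemma6_tuple maynard2016_lemma6_holds h7 c

end Maynard2016

end Literature.NumberTheory.Sieve
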